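import Summits.Parity.GeneralizedHardyLittlewood.Theorems.PrimeLevelFamEdgeMomentsBeyondDiagonalDiagDecorShiftedBlock
import HarnessLib

/-!
# Route `PrimeLevelFamEdge`, crux K_A `MomentsBeyondDiagonal` (stmt-Parity-20007), line «petersson_layers» v4, stub `stub_diag`:
# **the `L`-power weights of the per-order targets: for every `m`,
# `Sel(τ(k₁)τ(k₂)·L^m) = (π²/6)²·Φ_m(λ,P)·log^{m+1}M/log⁴M + O(log^mM/log⁴M)`,
# `Φ_m = Σ_{j≤m}Σ_{i≤j} C(m,j)C(j,i)2^{m−j}∫₀¹(λ−u)^{m−j}(u^iP)″(u^{j−i}P)″du`**, `L = 2λlog M − 2log g − log k₁ − log k₂`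

Census R3(ii), ANALYTIC HALF — the first monomial family of the order-`(1,1)` polynomial part
(`…DiagDecorWeightOneOne`: `ττ·[L³/24 + (E₀₀/4)L² + (E₀₁−2μ₂)L + E₁₁]`, `L = log(Q²/(g²k₁k₂))`, `λ = log Q/log M = 1/Δ′`),
for EVERY `m` at once, from the shifted blocks of `…DiagDecorShiftedBlock` via `L = 2B + ℓ⁺(k₁) + ℓ⁺(k₂)`:

* `selbergProd_finset_sum`, `selbergProd_const_mul` — linearity of the product-form Selberg sum
  `Σ_cΣ_g μ(g)c Σ_{k₁,k₂} y′(cgk₁)y′(cgk₂)·F(c,g,k₁,k₂)` in `F`;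
* `tauTau_Lpow_eq_sum_blocks` — pointwise: `τ(k₁)τ(k₂)L^m = Σ_{j≤m}Σ_{i≤j} C(m,j)C(j,i)2^{m−j}·(τ(k₁)ℓ⁺(k₁)^i)(τ(k₂)ℓ⁺(k₂)^{j−i})B^{m−j}`;
* `abs_selbergLpow_sub_le` — **the displayed asymptotic** (`0 ≤ λ ≤ 1`, `P₀ = P₁ = 0`, `M ≥ 3`).

Hand check of `Φ_m` against `Lines/petersson_layers_stub_diag_g8_orders.md`: `Φ₁ = 2(P′(1)² + λ∫P″²)` (order `(0,0)`:
`τ₀₀ = secondMomentForm/2` ✓), and `Φ₃/24` plus the `P₂`-family gives `τ₁₁ = B₁₁/2 = ½[(P′(1)+Δ′P(1))² + ∫P″²/(3Δ′)]` ✓.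
Def-free; theorems only. Helper `--supports stmt-Parity-20007`; closes nothing; K_A, K_B and the Parity summit are NOT
proved; nothing about Landau–Siegel zeros.

## References
* E. Kowalski, P. Michel, J. VanderKam, J. reine angew. Math. 526 (2000), (23)–(28) pp. 13–15 and Prop. 5.1 p. 18.
  [cite: KowalskiMichelVanderKam2000, (23)–(28) — derivation (diagonal main term in real Selberg coordinates)]
-/

noncomputable section

open scoped Real ArithmeticFunction.Moebius
open Finset ArithmeticFunction Polynomial MeasureTheory intervalIntegral

namespace Summit.Parity.GeneralizedHardyLittlewood.Theorems.MomentsBeyondDiagonal.DiagKernel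

open Literature.NumberTheory.LFunctions Literature.NumberTheory.LFunctions.KMV2000
open MollifierMainTerm (W)
open Literature.NumberTheory.Sieve (one_le_log_of_three_le)

/-! ### Linearity of the product-form Selberg sum -/

/-- **Additivity** of `Σ_cΣ_g μ(g)c Σ_{k₁,k₂} y′(cgk₁)y′(cgk₂)·F` in the weight `F`. [folklore] -/
theorem selbergProd_finset_sum {α : Type*} [DecidableEq α] (P : ℝ[X]) (M : ℝ) (s : Finset α)
    (F : α → ℕ → ℕ → ℕ → ℕ → ℝ) :
    ∑ c ∈ Icc 1 ⌊M⌋₊, ∑ g ∈ Icc 1 (⌊M⌋₊ / c), (μ g : ℝ) * c *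
        ∑ k₁ ∈ Icc 1 (⌊M⌋₊ / (c * g)), ∑ k₂ ∈ Icc 1 (⌊M⌋₊ / (c * g)),
          ((μ (c * g * k₁) : ℝ) * ((psi (c * g * k₁))⁻¹ *
              P.eval (Real.log (M / ((c * g * k₁ : ℕ) : ℝ)) / Real.log M))) / ((c * g * k₁ : ℕ) : ℝ) *
            (((μ (c * g * k₂) : ℝ) * ((psi (c * g * k₂))⁻¹ *
              P.eval (Real.log (M / ((c * g * k₂ : ℕ) : ℝ)) / Real.log M))) / ((c * g * k₂ : ℕ) : ℝ)) *
            ∑ a ∈ s, F a c g k₁ k₂ =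
      ∑ a ∈ s, ∑ c ∈ Icc 1 ⌊M⌋₊, ∑ g ∈ Icc 1 (⌊M⌋₊ / c), (μ g : ℝ) * c *
        ∑ k₁ ∈ Icc 1 (⌊M⌋₊ / (c * g)), ∑ k₂ ∈ Icc 1 (⌊M⌋₊ / (c * g)),
          ((μ (c * g * k₁) : ℝ) * ((psi (c * g * k₁))⁻¹ *
              P.eval (Real.log (M / ((c * g * k₁ : ℕ) : ℝ)) / Real.log M))) / ((c * g * k₁ : ℕ) : ℝ) *
            (((μ (c * g * k₂) : ℝ) * ((psi (c * g * k₂))⁻¹ *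
              P.eval (Real.log (M / ((c * g * k₂ : ℕ) : ℝ)) / Real.log M))) / ((c * g * k₂ : ℕ) : ℝ)) *
            F a c g k₁ k₂ := by
  induction s using Finset.induction_on with
  | empty => simp
  | insert a s ha ih =>
    simp only [Finset.sum_insert ha]
    rw [← ih]
    simp only [Finset.sum_add_distrib, mul_add]

/-- **Homogeneity** of the product-form Selberg sum in the weight. [folklore] -/
theorem selbergProd_const_mul (P : ℝ[X]) (M : ℝ) (κ : ℝ) (F : ℕ → ℕ → ℕ → ℕ → ℝ) :
    ∑ c ∈ Icc 1 ⌊M⌋₊, ∑ g ∈ Icc 1 (⌊M⌋₊ / c), (μ g : ℝ) * c *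
        ∑ k₁ ∈ Icc 1 (⌊M⌋₊ / (c * g)), ∑ k₂ ∈ Icc 1 (⌊M⌋₊ / (c * g)),
          ((μ (c * g * k₁) : ℝ) * ((psi (c * g * k₁))⁻¹ *
              P.eval (Real.log (M / ((c * g * k₁ : ℕ) : ℝ)) / Real.log M))) / ((c * g * k₁ : ℕ) : ℝ) *
            (((μ (c * g * k₂) : ℝ) * ((psi (c * g * k₂))⁻¹ *
              P.eval (Real.log (M / ((c * g * k₂ : ℕ) : ℝ)) / Real.log M))) / ((c * g * k₂ : ℕ) : ℝ)) *
            (κ * F c g k₁ k₂) =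
      κ * ∑ c ∈ Icc 1 ⌊M⌋₊, ∑ g ∈ Icc 1 (⌊M⌋₊ / c), (μ g : ℝ) * c *
        ∑ k₁ ∈ Icc 1 (⌊M⌋₊ / (c * g)), ∑ k₂ ∈ Icc 1 (⌊M⌋₊ / (c * g)),
          ((μ (c * g * k₁) : ℝ) * ((psi (c * g * k₁))⁻¹ *
              P.eval (Real.log (M / ((c * g * k₁ : ℕ) : ℝ)) / Real.log M))) / ((c * g * k₁ : ℕ) : ℝ) *
            (((μ (c * g * k₂) : ℝ) * ((psi (c * g * k₂))⁻¹ *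
              P.eval (Real.log (M / ((c * g * k₂ : ℕ) : ℝ)) / Real.log M))) / ((c * g * k₂ : ℕ) : ℝ)) *
            F c g k₁ k₂ := by
  simp only [Finset.mul_sum]
  refine Finset.sum_congr rfl fun c _ ↦ Finset.sum_congr rfl fun g _ ↦ Finset.sum_congr rfl fun k₁ _ ↦
    Finset.sum_congr rfl fun k₂ _ ↦ ?_
  ring

/-! ### `L = 2B + ℓ⁺(k₁) + ℓ⁺(k₂)` -/

/-- **Pointwise block expansion**: for `M > 0` and `c, g, k₁, k₂ ≥ 1`, with `ℓ⁺(k) = log((M/(cg))/k)`,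
`B = λlog M − log g − log(M/(cg))`:
`τ(k₁)τ(k₂)(2λlog M − 2log g − log k₁ − log k₂)^m = Σ_{j≤m}Σ_{i≤j} C(m,j)C(j,i)2^{m−j}·(τ(k₁)ℓ⁺(k₁)^i)(τ(k₂)ℓ⁺(k₂)^{j−i})B^{m−j}`.
[cite: KowalskiMichelVanderKam2000, (23) — derivation] -/
theorem tauTau_Lpow_eq_sum_blocks {M : ℝ} (hM : 0 < M) (lam : ℝ) (m : ℕ) {c g k₁ k₂ : ℕ} (hc : c ≠ 0)
    (hg : g ≠ 0) (hk₁ : k₁ ≠ 0) (hk₂ : k₂ ≠ 0) :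
    (k₁.divisors.card : ℝ) * (k₂.divisors.card : ℝ) *
        (2 * (lam * Real.log M) - 2 * Real.log g - Real.log k₁ - Real.log k₂) ^ m =
      ∑ j ∈ Finset.range (m + 1), ∑ i ∈ Finset.range (j + 1),
        (m.choose j : ℝ) * (j.choose i : ℝ) * 2 ^ (m - j) *
          (((k₁.divisors.card : ℝ) * Real.log (M / ((c * g : ℕ) : ℝ) / k₁) ^ i) *
            ((k₂.divisors.card : ℝ) * Real.log (M / ((c * g : ℕ) : ℝ) / k₂) ^ (j - i)) *
            (lam * Real.log M - Real.log g - Real.log (M / ((c * g : ℕ) : ℝ))) ^ (m - j)) := by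
  have hcg : (0 : ℝ) < ((c * g : ℕ) : ℝ) := by exact_mod_cast Nat.pos_of_ne_zero (mul_ne_zero hc hg)
  have hY : M / ((c * g : ℕ) : ℝ) ≠ 0 := (div_pos hM hcg).ne'
  have h1 : Real.log (M / ((c * g : ℕ) : ℝ) / k₁) = Real.log (M / ((c * g : ℕ) : ℝ)) - Real.log k₁ :=
    Real.log_div hY (by exact_mod_cast hk₁)
  have h2 : Real.log (M / ((c * g : ℕ) : ℝ) / k₂) = Real.log (M / ((c * g : ℕ) : ℝ)) - Real.log k₂ :=
    Real.log_div hY (by exact_mod_cast hk₂)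
  have hL : 2 * (lam * Real.log M) - 2 * Real.log g - Real.log k₁ - Real.log k₂ =
      (Real.log (M / ((c * g : ℕ) : ℝ) / k₁) + Real.log (M / ((c * g : ℕ) : ℝ) / k₂)) +
        2 * (lam * Real.log M - Real.log g - Real.log (M / ((c * g : ℕ) : ℝ))) := by
    rw [h1, h2]; ring
  rw [hL, add_pow, Finset.mul_sum]
  refine Finset.sum_congr rfl fun j _ ↦ ?_
  rw [add_pow, mul_pow, Finset.sum_mul, Finset.sum_mul, Finset.mul_sum]
  refine Finset.sum_congr rfl fun i _ ↦ ?_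
  ring

/-! ### The `L`-power asymptotic -/

/-- **`Sel(τ(k₁)τ(k₂)·L^m) = (π²/6)²Φ_m·log^{m+1}M/log⁴M + O(log^mM/log⁴M)`** for every `m`, `0 ≤ λ ≤ 1`, `P₀ = P₁ = 0`
(see the module docstring). [cite: KowalskiMichelVanderKam2000, (23)–(28) and Prop. 5.1 — derivation] -/
theorem abs_selbergLpow_sub_le (P : ℝ[X]) (hP0 : P.coeff 0 = 0) (hP1 : P.coeff 1 = 0) (m : ℕ)
    {lam : ℝ} (hlam0 : 0 ≤ lam) (hlam1 : lam ≤ 1) :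
    ∃ C : ℝ, 0 < C ∧ ∀ M : ℝ, 3 ≤ M →
      |∑ c ∈ Icc 1 ⌊M⌋₊, ∑ g ∈ Icc 1 (⌊M⌋₊ / c), (μ g : ℝ) * c *
          ∑ k₁ ∈ Icc 1 (⌊M⌋₊ / (c * g)), ∑ k₂ ∈ Icc 1 (⌊M⌋₊ / (c * g)),
            ((μ (c * g * k₁) : ℝ) * ((psi (c * g * k₁))⁻¹ *
                P.eval (Real.log (M / ((c * g * k₁ : ℕ) : ℝ)) / Real.log M))) / ((c * g * k₁ : ℕ) : ℝ) *
              (((μ (c * g * k₂) : ℝ) * ((psi (c * g * k₂))⁻¹ *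
                P.eval (Real.log (M / ((c * g * k₂ : ℕ) : ℝ)) / Real.log M))) / ((c * g * k₂ : ℕ) : ℝ)) *
              ((k₁.divisors.card : ℝ) * (k₂.divisors.card : ℝ) *
                (2 * (lam * Real.log M) - 2 * Real.log g - Real.log k₁ - Real.log k₂) ^ m) -
        (π ^ 2 / 6) ^ 2 * (∑ j ∈ Finset.range (m + 1), ∑ i ∈ Finset.range (j + 1),
            (m.choose j : ℝ) * (j.choose i : ℝ) * 2 ^ (m - j) *
              ∫ u in (0 : ℝ)..1, (((Polynomial.C lam - X) ^ (m - j) * derivative (derivative (X ^ i * P))) *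
                derivative (derivative (X ^ (j - i) * P))).eval u) *
          Real.log M ^ m * Real.log M / Real.log M ^ 4| ≤
        C * Real.log M ^ m / Real.log M ^ 4 := by
  -- one constant per block `(j, i)`
  have hex : ∀ j i : ℕ, ∃ C : ℝ, 0 < C ∧ ∀ M : ℝ, 3 ≤ M →
      |∑ c ∈ Icc 1 ⌊M⌋₊, ∑ g ∈ Icc 1 (⌊M⌋₊ / c), (μ g : ℝ) * c *
          ∑ k₁ ∈ Icc 1 (⌊M⌋₊ / (c * g)), ∑ k₂ ∈ Icc 1 (⌊M⌋₊ / (c * g)),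
            ((μ (c * g * k₁) : ℝ) * ((psi (c * g * k₁))⁻¹ *
                P.eval (Real.log (M / ((c * g * k₁ : ℕ) : ℝ)) / Real.log M))) / ((c * g * k₁ : ℕ) : ℝ) *
              (((μ (c * g * k₂) : ℝ) * ((psi (c * g * k₂))⁻¹ *
                P.eval (Real.log (M / ((c * g * k₂ : ℕ) : ℝ)) / Real.log M))) / ((c * g * k₂ : ℕ) : ℝ)) *
              (((k₁.divisors.card : ℝ) * Real.log (M / ((c * g : ℕ) : ℝ) / k₁) ^ i) *
                ((k₂.divisors.card : ℝ) * Real.log (M / ((c * g : ℕ) : ℝ) / k₂) ^ (j - i)) *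
                (lam * Real.log M - Real.log g - Real.log (M / ((c * g : ℕ) : ℝ))) ^ (m - j)) -
        (π ^ 2 / 6) ^ 2 * (∫ u in (0 : ℝ)..1,
            (((Polynomial.C lam - X) ^ (m - j) * derivative (derivative (X ^ i * P))) *
              derivative (derivative (X ^ (j - i) * P))).eval u) *
          Real.log M ^ ((m - j) + i + (j - i)) * Real.log M / Real.log M ^ 4| ≤
        C * Real.log M ^ ((m - j) + i + (j - i)) / Real.log M ^ 4 :=
    fun j i ↦ abs_selbergBlock_sub_le P hP0 hP1 (m - j) i (j - i) hlam0 hlam1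
  choose Cb hCb0 hCb using hex
  set K : ℝ := ∑ j ∈ Finset.range (m + 1), ∑ i ∈ Finset.range (j + 1),
    (m.choose j : ℝ) * (j.choose i : ℝ) * 2 ^ (m - j) * Cb j i with hK
  have hK0 : 0 ≤ K := Finset.sum_nonneg fun j _ ↦ Finset.sum_nonneg fun i _ ↦ by
    have := hCb0 j i; positivity
  refine ⟨K + 1, by positivity, fun M hM ↦ ?_⟩
  have hℓ1 : 1 ≤ Real.log M := one_le_log_of_three_le hM
  have hℓpos : 0 < Real.log M := by linarith
  have hM0 : 0 < M := by linarith
  set Xe : ℝ := Real.log M ^ m / Real.log M ^ 4 with hXe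
  have hXe0 : 0 ≤ Xe := by positivity
  -- Step 1: expand the weight pointwise and use linearity
  have hpt : ∀ c ∈ Icc 1 ⌊M⌋₊, ∀ g ∈ Icc 1 (⌊M⌋₊ / c), ∀ k₁ ∈ Icc 1 (⌊M⌋₊ / (c * g)), ∀ k₂ ∈ Icc 1 (⌊M⌋₊ / (c * g)),
      ((μ (c * g * k₁) : ℝ) * ((psi (c * g * k₁))⁻¹ *
          P.eval (Real.log (M / ((c * g * k₁ : ℕ) : ℝ)) / Real.log M))) / ((c * g * k₁ : ℕ) : ℝ) *
        (((μ (c * g * k₂) : ℝ) * ((psi (c * g * k₂))⁻¹ *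
          P.eval (Real.log (M / ((c * g * k₂ : ℕ) : ℝ)) / Real.log M))) / ((c * g * k₂ : ℕ) : ℝ)) *
        ((k₁.divisors.card : ℝ) * (k₂.divisors.card : ℝ) *
          (2 * (lam * Real.log M) - 2 * Real.log g - Real.log k₁ - Real.log k₂) ^ m) =
      ((μ (c * g * k₁) : ℝ) * ((psi (c * g * k₁))⁻¹ *
          P.eval (Real.log (M / ((c * g * k₁ : ℕ) : ℝ)) / Real.log M))) / ((c * g * k₁ : ℕ) : ℝ) *
        (((μ (c * g * k₂) : ℝ) * ((psi (c * g * k₂))⁻¹ *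
          P.eval (Real.log (M / ((c * g * k₂ : ℕ) : ℝ)) / Real.log M))) / ((c * g * k₂ : ℕ) : ℝ)) *
        ∑ j ∈ Finset.range (m + 1), (fun (j c g k₁ k₂ : ℕ) ↦ ∑ i ∈ Finset.range (j + 1),
          (m.choose j : ℝ) * (j.choose i : ℝ) * 2 ^ (m - j) *
          (((k₁.divisors.card : ℝ) * Real.log (M / ((c * g : ℕ) : ℝ) / k₁) ^ i) *
            ((k₂.divisors.card : ℝ) * Real.log (M / ((c * g : ℕ) : ℝ) / k₂) ^ (j - i)) *
            (lam * Real.log M - Real.log g - Real.log (M / ((c * g : ℕ) : ℝ))) ^ (m - j))) j c g k₁ k₂ := by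
    intro c hc g hg k₁ hk₁ k₂ hk₂
    have hc0 : c ≠ 0 := by have := (Finset.mem_Icc.1 hc).1; omega
    have hg0 : g ≠ 0 := by have := (Finset.mem_Icc.1 hg).1; omega
    have hk₁0 : k₁ ≠ 0 := by have := (Finset.mem_Icc.1 hk₁).1; omega
    have hk₂0 : k₂ ≠ 0 := by have := (Finset.mem_Icc.1 hk₂).1; omega
    rw [tauTau_Lpow_eq_sum_blocks hM0 lam m hc0 hg0 hk₁0 hk₂0]
  rw [Finset.sum_congr rfl fun c hc ↦ Finset.sum_congr rfl fun g hg ↦ congrArg _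
    (Finset.sum_congr rfl fun k₁ hk₁ ↦ Finset.sum_congr rfl fun k₂ hk₂ ↦ hpt c hc g hg k₁ hk₁ k₂ hk₂),
    selbergProd_finset_sum P M (Finset.range (m + 1))]
  rw [Finset.sum_congr rfl fun j _ ↦ selbergProd_finset_sum P M (Finset.range (j + 1))
    (fun (i c g k₁ k₂ : ℕ) ↦ (m.choose j : ℝ) * (j.choose i : ℝ) * 2 ^ (m - j) *
      (((k₁.divisors.card : ℝ) * Real.log (M / ((c * g : ℕ) : ℝ) / k₁) ^ i) *
        ((k₂.divisors.card : ℝ) * Real.log (M / ((c * g : ℕ) : ℝ) / k₂) ^ (j - i)) *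
        (lam * Real.log M - Real.log g - Real.log (M / ((c * g : ℕ) : ℝ))) ^ (m - j)))]
  simp only [selbergProd_const_mul]
  -- Step 2: the main term as the same double sum, and the termwise block asymptotics
  rw [Finset.mul_sum, Finset.sum_mul, Finset.sum_mul, Finset.sum_div, ← Finset.sum_sub_distrib]
  have hterm : ∀ j ∈ Finset.range (m + 1),
      |∑ i ∈ Finset.range (j + 1), (m.choose j : ℝ) * (j.choose i : ℝ) * 2 ^ (m - j) *
          ∑ c ∈ Icc 1 ⌊M⌋₊, ∑ g ∈ Icc 1 (⌊M⌋₊ / c), (μ g : ℝ) * c *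
            ∑ k₁ ∈ Icc 1 (⌊M⌋₊ / (c * g)), ∑ k₂ ∈ Icc 1 (⌊M⌋₊ / (c * g)),
              ((μ (c * g * k₁) : ℝ) * ((psi (c * g * k₁))⁻¹ *
                  P.eval (Real.log (M / ((c * g * k₁ : ℕ) : ℝ)) / Real.log M))) / ((c * g * k₁ : ℕ) : ℝ) *
                (((μ (c * g * k₂) : ℝ) * ((psi (c * g * k₂))⁻¹ *
                  P.eval (Real.log (M / ((c * g * k₂ : ℕ) : ℝ)) / Real.log M))) / ((c * g * k₂ : ℕ) : ℝ)) *
                (((k₁.divisors.card : ℝ) * Real.log (M / ((c * g : ℕ) : ℝ) / k₁) ^ i) *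
                  ((k₂.divisors.card : ℝ) * Real.log (M / ((c * g : ℕ) : ℝ) / k₂) ^ (j - i)) *
                  (lam * Real.log M - Real.log g - Real.log (M / ((c * g : ℕ) : ℝ))) ^ (m - j)) -
        (π ^ 2 / 6) ^ 2 * (∑ i ∈ Finset.range (j + 1),
            (m.choose j : ℝ) * (j.choose i : ℝ) * 2 ^ (m - j) *
              ∫ u in (0 : ℝ)..1, (((Polynomial.C lam - X) ^ (m - j) * derivative (derivative (X ^ i * P))) *
                derivative (derivative (X ^ (j - i) * P))).eval u) *
          Real.log M ^ m * Real.log M / Real.log M ^ 4| ≤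
        (∑ i ∈ Finset.range (j + 1), (m.choose j : ℝ) * (j.choose i : ℝ) * 2 ^ (m - j) * Cb j i) * Xe := by
    intro j hj
    have hjm : j ≤ m := Nat.lt_succ_iff.1 (Finset.mem_range.1 hj)
    rw [Finset.mul_sum, Finset.sum_mul, Finset.sum_mul, Finset.sum_div, ← Finset.sum_sub_distrib, Finset.sum_mul]
    refine (Finset.abs_sum_le_sum_abs _ _).trans (Finset.sum_le_sum fun i hi ↦ ?_)
    have hij : i ≤ j := Nat.lt_succ_iff.1 (Finset.mem_range.1 hi)
    have e : (m - j) + i + (j - i) = m := by omega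
    have h := hCb j i M hM
    rw [e] at h
    rw [show ∀ (a S I : ℝ), a * S - (π ^ 2 / 6) ^ 2 * (a * I) * Real.log M ^ m * Real.log M / Real.log M ^ 4 =
        a * (S - (π ^ 2 / 6) ^ 2 * I * Real.log M ^ m * Real.log M / Real.log M ^ 4) from fun a S I ↦ by ring,
      abs_mul, abs_of_nonneg (by positivity : (0 : ℝ) ≤ (m.choose j : ℝ) * (j.choose i : ℝ) * 2 ^ (m - j)),
      mul_assoc ((m.choose j : ℝ) * (j.choose i : ℝ) * 2 ^ (m - j)) (Cb j i) Xe]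
    refine mul_le_mul_of_nonneg_left ?_ (by positivity)
    rw [hXe, ← mul_div_assoc]
    exact h
  refine (Finset.abs_sum_le_sum_abs _ _).trans ((Finset.sum_le_sum hterm).trans ?_)
  rw [← Finset.sum_mul, ← hK]
  calc K * Xe ≤ (K + 1) * Xe := by gcongr; linarith
    _ = (K + 1) * Real.log M ^ m / Real.log M ^ 4 := by rw [hXe]; ring

end Summit.Parity.GeneralizedHardyLittlewood.Theorems.MomentsBeyondDiagonal.DiagKernel

end
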